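import Mathlib
import Summits.BirchSwinnertonDyer.BirchSwinnertonDyer.Theorems.SignedLowerHalvesKobayashiMainConjectureSmallImageLemmaPrimeReduction
import HarnessLib

/-!
# Toolkit for es's STEP 2 (D6 of LEAD's `kummer_diamond` line), I: the diamond character as a function on `Γ₀(N)` through `d_γ mod N`,
# CRT bookkeeping, and the cyclic-image bound (odd prime powers; `2^a` with `a ≤ 4` via LEMMA M)
(route `ManinLocalTwoThree`, crux C2 `ManinOddAtFour` stmt-BirchSwinnertonDyer-22967; cell bsd-f2-manin, prover p2 gen 21; nodes for the Lean proof of E-es-185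
`IndexFourForcesFreyTwistShape`, es g38 PROOF-Ees185-186.md §4 PROPOSITION A / MEMO-es §59.5 STEP 2; `--supports stmt-BirchSwinnertonDyer-22967`)

ABSTRACT CURRENCY (so that es g39's `indexFour_kummerDiamondReciprocity` and the Kummer layer plug in by `exact`): an additive group `V` (the points
`W₀(ℂ)`), a function `w : Γ₀(N) → V` (the diamond value `γ ↦ π₀(c₀·{∞,γ∞}_f/2)`), additive (`w (γγ′) = w γ + w γ′`, (F0)) and trivial on
`d_γ ≡ 1 (mod N)` (`{∞,γ∞}_f ∈ Λ₁ = 2Λ₀` in the index-`4` world).  Lower-right entries are read in `ZMod`: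
`d_γ := (((γ : SL(2,ℤ)) 1 1 : ℤ) : ZMod m)`.

* §1 `Γ₀(N)` bookkeeping: `lowerRight_mul_cast` (`d_{γγ′} ≡ d_γ d_γ′`), `lowerRight_inv_mul_cast` (`d_{γ⁻¹} d_γ ≡ 1`), `isCoprime_lowerRight`,
  (every integer coprime to `N` is a `d_γ`, exactly: the tree's `SmallImageLemmaPrimeReduction.exists_gamma0_apply_one_one_eq`), `exists_gamma0_lowerRight_eq_neg_one`, `exists_unitsHom_lowerRight`
  (`γ ↦ d_γ` as a homomorphism `Γ₀(N) → (ℤ/m)ˣ`, `m ∣ N`, existence form).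
* §2 CRT for integers: `exists_int_cast_eq_cast_eq`, `intCast_zmod_mul_eq_iff_of_coprime`, `isCoprime_of_cast_mul_eq_one`.
* §3 the `w`-calculus: `w_one_eq`, `w_inv_eq`, `w_zpow_eq`, `w_eq_of_cast_eq` (`w` factors through `d_γ mod m` once it kills `d_γ ≡ 1 (mod m)`),
  `zsmul_eq_zero_or_eq` (`k • v ∈ {0, v}` if `v + v = 0`).
* §4 the cyclic bound: `exists_generator_of_isCyclic` / `exists_forall_eq_zero_or_eq_of_isCyclic` — for `N = Q′·y`, `gcd(Q′, y) = 1`, `Q ∣ Q′` with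
  `(ℤ/Q)ˣ` cyclic and `w` of exponent `2` trivial on `d_γ ≡ 1 (mod Q·y)`, the values `w γ` over `d_γ ≡ 1 (mod y)` (the `Q′`-component `ϖ_{Q′}` of es's
  diamond character) lie in `{0, v}` for one `v`; instances `exists_forall_eq_zero_or_eq_primePow` (`Q = p^b`, `p` odd) and
  `exists_forall_eq_zero_or_eq_twoPow_le_two` (`Q = 2^c ∣ 2^a`, `c ≤ 2` — the LEMMA M conductor at `2` when `a ≤ 4`).
UNCONDITIONAL group theory / elementary number theory; nothing about C2, Manin's conjecture or BSD is proved.  No definitions, no sorry. [folklore]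
[cite: Stevens1989, §2] [cite: Manin1972, Prop. 1.4 / Thm. 1.6]
-/

set_option autoImplicit false
-- lint-debt: the directory name repeats the summit name (sibling precedent `ManinLocalTwoThreeKummerDiamondStepTwoGroupLemmas.lean`)
set_option linter.dupNamespace false

open scoped MatrixGroups
open CongruenceSubgroup

namespace Summit.BirchSwinnertonDyer.BirchSwinnertonDyer.Theorems.ManinLocalTwoThree.StepTwo

variable {N : ℕ}

/-! ## §1 `Γ₀(N)`: the lower-right entry mod `N` is multiplicative -/

/-- `d_{γγ′} ≡ d_γ · d_γ′ (mod m)` for `γ, γ′ ∈ Γ₀(N)` and `m ∣ N` (the lower-left entries vanish mod `N`). [folklore] -/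
theorem lowerRight_mul_cast (γ γ' : Gamma0 N) {m : ℕ} (hm : m ∣ N) :
    ((((γ * γ' : Gamma0 N) : SL(2, ℤ)) 1 1 : ℤ) : ZMod m) =
      (((γ : SL(2, ℤ)) 1 1 : ℤ) : ZMod m) * (((γ' : SL(2, ℤ)) 1 1 : ℤ) : ZMod m) := by
  have hc : ((((γ : SL(2, ℤ)) 1 0 : ℤ)) : ZMod m) = 0 := by
    have h := Gamma0_mem.mp γ.property
    rw [ZMod.intCast_zmod_eq_zero_iff_dvd] at h ⊢
    exact dvd_trans (Int.natCast_dvd_natCast.mpr hm) h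
  have e : (((γ * γ' : Gamma0 N) : SL(2, ℤ)) 1 1 : ℤ) =
      ((γ : SL(2, ℤ)) 1 0 : ℤ) * ((γ' : SL(2, ℤ)) 0 1 : ℤ) + ((γ : SL(2, ℤ)) 1 1 : ℤ) * ((γ' : SL(2, ℤ)) 1 1 : ℤ) := by
    rw [Subgroup.coe_mul, Matrix.SpecialLinearGroup.coe_mul, Matrix.mul_apply, Fin.sum_univ_two]
  rw [e]; push_cast; rw [hc, zero_mul, zero_add]

/-- `d_{γ⁻¹} · d_γ ≡ 1 (mod m)` for `γ ∈ Γ₀(N)`, `m ∣ N` (`d_{γ⁻¹} = a_γ` and `a_γ d_γ − b_γ c_γ = 1`). [folklore] -/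
theorem lowerRight_inv_mul_cast (γ : Gamma0 N) {m : ℕ} (hm : m ∣ N) :
    ((((γ⁻¹ : Gamma0 N) : SL(2, ℤ)) 1 1 : ℤ) : ZMod m) * (((γ : SL(2, ℤ)) 1 1 : ℤ) : ZMod m) = 1 := by
  have hc : ((((γ : SL(2, ℤ)) 1 0 : ℤ)) : ZMod m) = 0 := by
    have h := Gamma0_mem.mp γ.property
    rw [ZMod.intCast_zmod_eq_zero_iff_dvd] at h ⊢
    exact dvd_trans (Int.natCast_dvd_natCast.mpr hm) h
  have e : (((γ⁻¹ : Gamma0 N) : SL(2, ℤ)) 1 1 : ℤ) = ((γ : SL(2, ℤ)) 0 0 : ℤ) := by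
    rw [Subgroup.coe_inv, Matrix.SpecialLinearGroup.coe_inv, Matrix.adjugate_fin_two]
    simp
  have hdet : ((γ : SL(2, ℤ)) 0 0 : ℤ) * ((γ : SL(2, ℤ)) 1 1 : ℤ) - ((γ : SL(2, ℤ)) 0 1 : ℤ) * ((γ : SL(2, ℤ)) 1 0 : ℤ) = 1 := by
    have h := (γ : SL(2, ℤ)).prop
    rw [Matrix.det_fin_two] at h
    exact h
  rw [e]
  have h1 : (((((γ : SL(2, ℤ)) 0 0 : ℤ) * ((γ : SL(2, ℤ)) 1 1 : ℤ) - ((γ : SL(2, ℤ)) 0 1 : ℤ) * ((γ : SL(2, ℤ)) 1 0 : ℤ) : ℤ)) : ZMod m) = 1 := by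
    rw [hdet]; push_cast; rfl
  push_cast at h1
  rw [hc, mul_zero, sub_zero] at h1
  exact h1

/-- The lower-right entry of `γ ∈ Γ₀(N)` is coprime to `N`. [folklore] -/
theorem isCoprime_lowerRight (γ : Gamma0 N) : IsCoprime (((γ : SL(2, ℤ)) 1 1 : ℤ)) (N : ℤ) := by
  have hc : (N : ℤ) ∣ ((γ : SL(2, ℤ)) 1 0 : ℤ) := by
    have h := Gamma0_mem.mp γ.property
    rwa [ZMod.intCast_zmod_eq_zero_iff_dvd] at h
  have hdet : ((γ : SL(2, ℤ)) 0 0 : ℤ) * ((γ : SL(2, ℤ)) 1 1 : ℤ) - ((γ : SL(2, ℤ)) 0 1 : ℤ) * ((γ : SL(2, ℤ)) 1 0 : ℤ) = 1 := by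
    have h := (γ : SL(2, ℤ)).prop
    rw [Matrix.det_fin_two] at h
    exact h
  obtain ⟨k, hk⟩ := hc
  exact ⟨((γ : SL(2, ℤ)) 0 0 : ℤ), -(((γ : SL(2, ℤ)) 0 1 : ℤ) * k), by linear_combination hdet + ((γ : SL(2, ℤ)) 0 1 : ℤ) * hk⟩

/-- `−I ∈ Γ₀(N)`, with lower-right entry `−1`. [folklore] -/
theorem exists_gamma0_lowerRight_eq_neg_one : ∃ γ : Gamma0 N, ((γ : SL(2, ℤ)) 1 1 : ℤ) = -1 := by
  have hM : (-1 : SL(2, ℤ)) ∈ Gamma0 N := by rw [Gamma0_mem]; simp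
  exact ⟨⟨-1, hM⟩, by simp⟩

/-! ## §2 CRT for integers -/

/-- CRT: for coprime `Q, y` and integers `a, b` there is an integer `≡ a (mod Q)`, `≡ b (mod y)`. [folklore] -/
theorem exists_int_cast_eq_cast_eq {Q y : ℕ} (h : Nat.Coprime Q y) (a b : ℤ) :
    ∃ e : ℤ, (e : ZMod Q) = (a : ZMod Q) ∧ (e : ZMod y) = (b : ZMod y) := by
  obtain ⟨u, v, huv⟩ := Nat.isCoprime_iff_coprime.mpr h
  refine ⟨a * (v * y) + b * (u * Q), ?_, ?_⟩
  · rw [ZMod.intCast_eq_intCast_iff_dvd_sub]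
    exact ⟨u * (a - b), by linear_combination (-a) * huv⟩
  · rw [ZMod.intCast_eq_intCast_iff_dvd_sub]
    exact ⟨v * (b - a), by linear_combination (-b) * huv⟩

/-- CRT uniqueness: for coprime `Q, y`, `s ≡ t (mod Qy)` iff `s ≡ t (mod Q)` and `s ≡ t (mod y)`. [folklore] -/
theorem intCast_zmod_mul_eq_iff_of_coprime {Q y : ℕ} (h : Nat.Coprime Q y) (s t : ℤ) :
    (s : ZMod (Q * y)) = (t : ZMod (Q * y)) ↔ (s : ZMod Q) = (t : ZMod Q) ∧ (s : ZMod y) = (t : ZMod y) := by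
  simp only [ZMod.intCast_eq_intCast_iff_dvd_sub]
  push_cast
  constructor
  · intro hst
    exact ⟨dvd_trans (dvd_mul_right _ _) hst, dvd_trans (dvd_mul_left _ _) hst⟩
  · rintro ⟨hQ, hy⟩
    exact IsCoprime.mul_dvd (Nat.isCoprime_iff_coprime.mpr h) hQ hy

/-- An integer that is `≡` a unit mod `Q` and `≡ 1 (mod y)` is coprime to `N = Q·y`: if `e·d ≡ 1 (mod Q)` and `e ≡ 1 (mod y)` then
`IsCoprime e N`. [folklore] -/
theorem isCoprime_of_cast_mul_eq_one {Q y : ℕ} (hQy : Q * y = N) (h : Nat.Coprime Q y) {e d : ℤ}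
    (hQ : ((e * d : ℤ) : ZMod Q) = 1) (hy : (e : ZMod y) = 1) : IsCoprime e (N : ℤ) := by
  -- `g ≡ d (Q)`, `g ≡ 1 (y)`; then `e g ≡ 1 (mod N)`
  obtain ⟨g, hgQ, hgy⟩ := exists_int_cast_eq_cast_eq h d 1
  have h1 : ((e * g : ℤ) : ZMod (Q * y)) = ((1 : ℤ) : ZMod (Q * y)) := by
    rw [intCast_zmod_mul_eq_iff_of_coprime h]
    constructor
    · push_cast at hQ hgQ ⊢; rw [hgQ]; exact hQ
    · push_cast at hy hgy ⊢; rw [hgy, hy, one_mul]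
  rw [ZMod.intCast_eq_intCast_iff_dvd_sub] at h1
  obtain ⟨k, hk⟩ := h1
  refine ⟨g, k, ?_⟩
  have hN : ((Q * y : ℕ) : ℤ) = (N : ℤ) := by rw [hQy]
  rw [← hN]
  linear_combination -hk

/-- **The lower-right entry as a units-valued homomorphism** `Γ₀(N) → (ℤ/m)ˣ` for `m ∣ N` (existence form; `d_{γ⁻¹}` is the inverse).
[folklore] -/
theorem exists_unitsHom_lowerRight {m : ℕ} (hm : m ∣ N) :
    ∃ φ : Gamma0 N →* (ZMod m)ˣ, ∀ γ : Gamma0 N, ((φ γ : (ZMod m)ˣ) : ZMod m) = (((γ : SL(2, ℤ)) 1 1 : ℤ) : ZMod m) := by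
  let u : Gamma0 N → (ZMod m)ˣ := fun γ ↦
    ⟨(((γ : SL(2, ℤ)) 1 1 : ℤ) : ZMod m), ((((γ⁻¹ : Gamma0 N) : SL(2, ℤ)) 1 1 : ℤ) : ZMod m),
      by rw [mul_comm]; exact lowerRight_inv_mul_cast γ hm, lowerRight_inv_mul_cast γ hm⟩
  refine ⟨{ toFun := u, map_one' := ?_, map_mul' := ?_ }, fun γ ↦ rfl⟩
  · ext; simp [u]
  · intro γ γ'; ext; simp only [u, Units.val_mul]; exact lowerRight_mul_cast γ γ' hm

/-! ## §3 The `w`-calculus: an additive function on `Γ₀(N)` trivial on `d_γ ≡ 1` -/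

section WCalculus

variable {V : Type*} [AddCommGroup V] (w : Gamma0 N → V)

/-- `w(1) = 0`. [folklore] -/
theorem w_one_eq (hmul : ∀ γ γ' : Gamma0 N, w (γ * γ') = w γ + w γ') : w 1 = 0 := by
  have h := hmul 1 1
  rw [mul_one] at h
  -- `w 1 = w 1 + w 1`
  have : w 1 + w 1 = w 1 + 0 := by rw [add_zero]; exact h.symm
  exact add_left_cancel this

/-- `w(γ⁻¹) = −w(γ)`. [folklore] -/
theorem w_inv_eq (hmul : ∀ γ γ' : Gamma0 N, w (γ * γ') = w γ + w γ') (γ : Gamma0 N) : w γ⁻¹ = -w γ := by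
  have h := hmul γ⁻¹ γ
  rw [inv_mul_cancel, w_one_eq w hmul] at h
  exact (neg_eq_of_add_eq_zero_left h.symm).symm

/-- `w(γ^k) = k • w(γ)` (`k ∈ ℤ`). [folklore] -/
theorem w_zpow_eq (hmul : ∀ γ γ' : Gamma0 N, w (γ * γ') = w γ + w γ') (γ : Gamma0 N) (k : ℤ) : w (γ ^ k) = k • w γ := by
  let φ : Gamma0 N →* Multiplicative V :=
    { toFun := fun γ ↦ Multiplicative.ofAdd (w γ)
      map_one' := by rw [w_one_eq w hmul]; rfl
      map_mul' := fun a b ↦ by rw [hmul]; rfl }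
  have h := map_zpow φ γ k
  simp only [φ, MonoidHom.coe_mk, OneHom.coe_mk] at h
  rw [← ofAdd_zsmul] at h
  exact Multiplicative.ofAdd.injective h

/-- **`w` factors through `d_γ mod m`** whenever it kills `d_γ ≡ 1 (mod m)` (`m ∣ N`): `d_γ ≡ d_γ′ (mod m) ⟹ w γ = w γ′`.
(With `m = N` this is the diamond character as a function of `d_γ mod N`.) [folklore] -/
theorem w_eq_of_cast_eq (hmul : ∀ γ γ' : Gamma0 N, w (γ * γ') = w γ + w γ') {m : ℕ} (hm : m ∣ N)
    (hker : ∀ γ : Gamma0 N, ((((γ : SL(2, ℤ)) 1 1 : ℤ)) : ZMod m) = 1 → w γ = 0) {γ γ' : Gamma0 N}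
    (h : ((((γ : SL(2, ℤ)) 1 1 : ℤ)) : ZMod m) = ((((γ' : SL(2, ℤ)) 1 1 : ℤ)) : ZMod m)) : w γ = w γ' := by
  have hδ : w (γ' * γ⁻¹) = 0 := by
    apply hker
    rw [lowerRight_mul_cast _ _ hm, ← h, mul_comm]
    exact lowerRight_inv_mul_cast γ hm
  have e : γ' = γ' * γ⁻¹ * γ := by group
  rw [e, hmul, hδ, zero_add]

/-- `k • v ∈ {0, v}` when `v + v = 0`. [folklore] -/
theorem zsmul_eq_zero_or_eq {v : V} (hv : v + v = 0) (k : ℤ) : k • v = 0 ∨ k • v = v := by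
  have h2 : (2 : ℤ) • v = 0 := by rw [two_zsmul]; exact hv
  obtain ⟨j, hj | hj⟩ := Int.even_or_odd' k
  · left; rw [hj, mul_comm, mul_zsmul, h2, zsmul_zero]
  · right; rw [hj, add_zsmul, mul_comm, mul_zsmul, h2, zsmul_zero, zero_add, one_zsmul]

/-! ## §4 The cyclic bound: `ϖ_Q` takes at most one non-zero value when it factors through a cyclic `(ℤ/Q)ˣ` -/

/-- **Cyclic bound (with a conductor).**  `N = Q′·y`, `gcd(Q′, y) = 1`, `Q ∣ Q′` with `(ℤ/Q)ˣ` cyclic, `w` additive of exponent `2` and trivial on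
`d_γ ≡ 1 (mod Q·y)` (so the `Q′`-component of the diamond character factors through `(ℤ/Q)ˣ`): there is ONE `v` with `w γ ∈ {0, v}` for every `γ` with
`d_γ ≡ 1 (mod y)`, and a `γ₀` (`d_{γ₀} ≡ 1 (mod y)`, `w γ₀ = v`) through whose powers every such `γ` factors:
`d_γ ≡ d_{γ₀^k} (mod Q·y)` and `w γ = k • v` — es's «`(ℤ/p^v)ˣ/□ ≅ ℤ/2`, so `im ϖ_Q` has order `≤ 2`» and «`(ℤ/2^k)ˣ`, `k ≤ 2`, cyclic». [folklore] -/
theorem exists_generator_of_isCyclic [NeZero N] (hmul : ∀ γ γ' : Gamma0 N, w (γ * γ') = w γ + w γ') (h2 : ∀ γ : Gamma0 N, w γ + w γ = 0)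
    {Q Q' y : ℕ} (hQ : Q ∣ Q') (hQy : Q' * y = N) (hcop : Nat.Coprime Q' y) [IsCyclic (ZMod Q)ˣ]
    (hker : ∀ γ : Gamma0 N, ((((γ : SL(2, ℤ)) 1 1 : ℤ)) : ZMod (Q * y)) = 1 → w γ = 0) :
    ∃ γ₀ : Gamma0 N, ((((γ₀ : SL(2, ℤ)) 1 1 : ℤ)) : ZMod y) = 1 ∧
      ∀ γ : Gamma0 N, ((((γ : SL(2, ℤ)) 1 1 : ℤ)) : ZMod y) = 1 →
        ∃ k : ℤ, ((((γ : SL(2, ℤ)) 1 1 : ℤ)) : ZMod (Q * y)) = ((((γ₀ ^ k : Gamma0 N) : SL(2, ℤ)) 1 1 : ℤ) : ZMod (Q * y)) ∧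
          w γ = k • w γ₀ := by
  subst hQy
  haveI : NeZero Q' := ⟨fun h ↦ NeZero.ne (Q' * y) (by rw [h, zero_mul])⟩
  haveI : NeZero Q := ⟨fun h ↦ NeZero.ne Q' (Nat.eq_zero_of_zero_dvd (h ▸ hQ))⟩
  have hQN : Q ∣ Q' * y := dvd_trans hQ (dvd_mul_right Q' y)
  have hyN : y ∣ Q' * y := dvd_mul_left y Q'
  have hcopQ : Nat.Coprime Q y := Nat.Coprime.coprime_dvd_left hQ hcop
  have hQyN : Q * y ∣ Q' * y := mul_dvd_mul_right hQ y
  obtain ⟨φQ, hφQ⟩ := exists_unitsHom_lowerRight (N := Q' * y) hQN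
  obtain ⟨φy, hφy⟩ := exists_unitsHom_lowerRight (N := Q' * y) hyN
  obtain ⟨g, hg⟩ := IsCyclic.exists_generator (α := (ZMod Q)ˣ)
  obtain ⟨G, hG⟩ := ZMod.unitsMap_surjective hQ g
  -- an element `γ₀` with `d ≡ G (mod Q′)` (so `≡ g (mod Q)`), `d ≡ 1 (mod y)`
  obtain ⟨e, heQ, hey⟩ := exists_int_cast_eq_cast_eq hcop (((G : ZMod Q').val : ℕ) : ℤ) 1
  have heQ' : (e : ZMod Q') = (G : ZMod Q') := by rw [heQ]; push_cast; exact ZMod.natCast_zmod_val _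
  have heg : (e : ZMod Q) = (g : ZMod Q) := by
    rw [← ZMod.cast_intCast hQ e, heQ', ← hG]; rfl
  have hey' : (e : ZMod y) = 1 := by rw [hey]; push_cast; rfl
  have hcopr : IsCoprime e ((Q' * y : ℕ) : ℤ) := by
    refine isCoprime_of_cast_mul_eq_one rfl hcop (d := ((((G⁻¹ : (ZMod Q')ˣ) : ZMod Q').val : ℕ) : ℤ)) ?_ hey'
    push_cast
    rw [heQ', ZMod.natCast_zmod_val, Units.mul_inv]
  obtain ⟨γ₀, hγ₀⟩ := SmallImageLemmaPrimeReduction.exists_gamma0_apply_one_one_eq hcopr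
  have hφγ₀ : φQ γ₀ = g := by ext; rw [hφQ, hγ₀, heg]
  have hφyγ₀ : φy γ₀ = 1 := by ext; rw [hφy, hγ₀, hey']; rfl
  refine ⟨γ₀, by rw [hγ₀, hey'], fun γ hγ ↦ ?_⟩
  obtain ⟨k, hk⟩ := Subgroup.mem_zpowers_iff.mp (hg (φQ γ))
  -- `γ` and `γ₀^k` have the same `d` mod `Q` and mod `y`, hence mod `Q·y`
  have hQ' : ((((γ : SL(2, ℤ)) 1 1 : ℤ)) : ZMod Q) = ((((γ₀ ^ k : Gamma0 (Q' * y)) : SL(2, ℤ)) 1 1 : ℤ) : ZMod Q) := by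
    rw [← hφQ, ← hφQ, map_zpow, hφγ₀, hk]
  have hy' : ((((γ : SL(2, ℤ)) 1 1 : ℤ)) : ZMod y) = ((((γ₀ ^ k : Gamma0 (Q' * y)) : SL(2, ℤ)) 1 1 : ℤ) : ZMod y) := by
    rw [hγ, ← hφy (γ₀ ^ k), map_zpow, hφyγ₀, one_zpow]; rfl
  have hN' : ((((γ : SL(2, ℤ)) 1 1 : ℤ)) : ZMod (Q * y)) = ((((γ₀ ^ k : Gamma0 (Q' * y)) : SL(2, ℤ)) 1 1 : ℤ) : ZMod (Q * y)) := by
    rw [intCast_zmod_mul_eq_iff_of_coprime hcopQ]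
    exact ⟨hQ', hy'⟩
  refine ⟨k, hN', ?_⟩
  rw [w_eq_of_cast_eq w hmul hQyN hker hN', w_zpow_eq w hmul]

/-- **Cyclic bound, value form**: under the hypotheses of `exists_generator_of_isCyclic`, `∃ v, ∀ γ, d_γ ≡ 1 (mod y) → w γ ∈ {0, v}`. [folklore] -/
theorem exists_forall_eq_zero_or_eq_of_isCyclic [NeZero N] (hmul : ∀ γ γ' : Gamma0 N, w (γ * γ') = w γ + w γ')
    (h2 : ∀ γ : Gamma0 N, w γ + w γ = 0) {Q Q' y : ℕ} (hQ : Q ∣ Q') (hQy : Q' * y = N) (hcop : Nat.Coprime Q' y)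
    [IsCyclic (ZMod Q)ˣ] (hker : ∀ γ : Gamma0 N, ((((γ : SL(2, ℤ)) 1 1 : ℤ)) : ZMod (Q * y)) = 1 → w γ = 0) :
    ∃ v : V, ∀ γ : Gamma0 N, ((((γ : SL(2, ℤ)) 1 1 : ℤ)) : ZMod y) = 1 → w γ = 0 ∨ w γ = v := by
  obtain ⟨γ₀, -, hγ₀⟩ := exists_generator_of_isCyclic w hmul h2 hQ hQy hcop hker
  refine ⟨w γ₀, fun γ hγ ↦ ?_⟩
  obtain ⟨k, -, hk⟩ := hγ₀ γ hγ
  rw [hk]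
  exact zsmul_eq_zero_or_eq (h2 γ₀) k

/-- The odd-prime-power instance: `Q = Q′ = p^b`, `p` an odd prime, `w` trivial on `d_γ ≡ 1 (mod N)`. [folklore] -/
theorem exists_forall_eq_zero_or_eq_primePow [NeZero N] (hmul : ∀ γ γ' : Gamma0 N, w (γ * γ') = w γ + w γ')
    (hone : ∀ γ : Gamma0 N, ((((γ : SL(2, ℤ)) 1 1 : ℤ)) : ZMod N) = 1 → w γ = 0) (h2 : ∀ γ : Gamma0 N, w γ + w γ = 0)
    {p b y : ℕ} (hp : p.Prime) (hp2 : p ≠ 2) (hQy : p ^ b * y = N) (hcop : Nat.Coprime (p ^ b) y) :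
    ∃ v : V, ∀ γ : Gamma0 N, ((((γ : SL(2, ℤ)) 1 1 : ℤ)) : ZMod y) = 1 → w γ = 0 ∨ w γ = v := by
  haveI : IsCyclic (ZMod (p ^ b))ˣ := ZMod.isCyclic_units_of_prime_pow p hp hp2 b
  exact exists_forall_eq_zero_or_eq_of_isCyclic w hmul h2 dvd_rfl hQy hcop (by rw [hQy]; exact hone)

/-- The small-`2`-power instance: `Q = 2^c ∣ Q′ = 2^a`, `c ≤ 2`, `w` trivial on `d_γ ≡ 1 (mod 2^c·y)` (LEMMA M when `c = ⌈a/2⌉`). [folklore] -/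
theorem exists_forall_eq_zero_or_eq_twoPow_le_two [NeZero N] (hmul : ∀ γ γ' : Gamma0 N, w (γ * γ') = w γ + w γ')
    (h2 : ∀ γ : Gamma0 N, w γ + w γ = 0) {c a y : ℕ} (hc : c ≤ 2) (hca : c ≤ a) (hQy : 2 ^ a * y = N)
    (hcop : Nat.Coprime (2 ^ a) y) (hker : ∀ γ : Gamma0 N, ((((γ : SL(2, ℤ)) 1 1 : ℤ)) : ZMod (2 ^ c * y)) = 1 → w γ = 0) :
    ∃ v : V, ∀ γ : Gamma0 N, ((((γ : SL(2, ℤ)) 1 1 : ℤ)) : ZMod y) = 1 → w γ = 0 ∨ w γ = v := by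
  haveI : IsCyclic (ZMod (2 ^ c))ˣ := by
    interval_cases c
    · exact ZMod.isCyclic_units_one
    · exact ZMod.isCyclic_units_two
    · exact ZMod.isCyclic_units_four
  exact exists_forall_eq_zero_or_eq_of_isCyclic w hmul h2 (pow_dvd_pow 2 hca) hQy hcop hker

end WCalculus

end Summit.BirchSwinnertonDyer.BirchSwinnertonDyer.Theorems.ManinLocalTwoThree.StepTwo
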